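import Literature.Probability.RandomGraphs.PlantedClique
import Mathlib.Analysis.SpecialFunctions.Exp
import Mathlib.Analysis.SpecialFunctions.Log.Basic
import Mathlib.Analysis.SpecialFunctions.Pow.Real
import HarnessLib

/-!
# Uniqueness of the planted clique: a first-moment bound

For the planted-clique law `G(n, 1/2, k)` (`plantedCliqueJoint n k` of `PlantedClique.lean`: a
uniformly random `k`-set `S`, then `G(n,1/2)` with all edges inside `S` switched on) we PROVE the
standard union (first-moment) bound behind "the planted clique is almost surely the unique
largest clique" (Jerrum 1992, §1; Kučera 1995, §1; Alon–Krivelevich–Sudakov 1998, §1: "finds,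
almost surely, the unique largest clique of size `k`"):

* `toOuterMeasure_not_isUniqueMaxClique_le` — for `1 ≤ k ≤ n`,
  `Pr[S is not the unique maximum clique] ≤ n³ · 2^{-⌊(k-1)/2⌋}`;
* `one_sub_le_uniqueMaxCliqueProb` — the complementary form;
* `plantedCliqueUniqueWhp_of_sqrt_le` — hence `PlantedCliqueUniqueWhp k` whenever
  `c √n ≤ k n ≤ n` eventually (`c > 0`), the regime of AKS 1998 (used by
  `PlantedCliqueFactsProofs.aks_unique_holds`).

## Proof

If `S` (`|S| = k ≥ 1`) is not the unique maximum clique of `G = plant S x` there is a clique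
`T ≠ S` with `|T| = k` (shrink a competitor around a vertex outside `S`). For such `T` every edge
of `K_n` inside `T` but not inside `S` (the finset `crossEdges S T`) must be an edge of the random
part `x`, an event of probability `2^{-|crossEdges S T|}` under the uniform `x`
(`toOuterMeasure_forall_eq_true_le`, by an injection `{x good} × 2^{D} ↪ 2^{E}`). Counting ordered
pairs `(u, v)`, `u ∈ T \ S`, `v ∈ T`, `u ≠ v` (at most two per edge) gives
`2 |crossEdges S T| ≥ j (k - 1)`, `j = |T \ S|`, so the event has probability `≤ r^j`,
`r = 2^{-⌊(k-1)/2⌋}`; and `T ↦ (T \ S, S \ T)` injects the `T` with `|T \ S| = j` into pairs of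
`j`-sets, at most `n^j k^j` of them. Hence `Pr[fail | S] ≤ Σ_{j=1}^{k} (n k r)^j ≤ n³ r` (if
`nkr ≤ 1` each term is `≤ nkr` and there are `k ≤ n` terms; otherwise `n³ r ≥ nkr > 1`).
Averaging over `S` keeps the bound. In the regime `k ≥ c√n`,
`n³ 2^{-⌊(k-1)/2⌋} ≤ 2 n³ e^{-(c log 2 / 2)√n} → 0`.

The constant is not optimised (the truth is uniqueness down to `k ≥ (2+ε) log₂ n`); the bound
`n³ 2^{-⌊(k-1)/2⌋}` tends to `0` as soon as `k(n) - 6 log₂ n → ∞`.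

## References

* N. Alon, M. Krivelevich, B. Sudakov, *Finding a large hidden clique in a random graph*, Random
  Structures Algorithms 13 (1998) 457–466, §1 [AlonKrivelevichSudakov1998].
* M. Jerrum, *Large cliques elude the Metropolis process*, RSA 3 (1992) 347–359, §1 [Jerrum1992].
-/

noncomputable section

namespace Literature.Probability.RandomGraphs.PlantedClique

open Finset Filter
open scoped _root_.Topology ENNReal

variable {n : ℕ}

/-! ### The constrained edges of a competing clique -/

/-- Notation (local, not a declaration): `crossEdges S T` is the finset of edges of `K_n` with
both endpoints in `T` but not both in `S` — the edge indicators a clique on `T` forces to be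
`true` in `plant S x`. -/
local notation3 (prettyPrint := false) "crossEdges(" S ", " T ")" =>
  Finset.filter (fun e : (⊤ : SimpleGraph (Fin _)).edgeSet =>
    Subtype.val e ∈ Finset.sym2 T ∧ Subtype.val e ∉ Finset.sym2 S) Finset.univ

/-- If `T` is a clique of `plant S x` then every edge inside `T` not inside `S` is an edge of the
random part `x`. [folklore] -/
theorem eq_true_of_isClique_plant {S T : Finset (Fin n)} {x : EdgeVec n}
    (hT : (graphOfEdgeVec (plant S x)).IsClique (T : Set (Fin n))) :
    ∀ e ∈ crossEdges(S, T), x e = true := by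
  classical
  rintro ⟨e, he⟩ hmem
  simp only [mem_filter, mem_univ, true_and, Finset.mem_sym2_iff] at hmem
  obtain ⟨hT', hS'⟩ := hmem
  revert he hT' hS'
  refine Sym2.ind (fun u v => ?_) e
  intro he hT' hS'
  have huv : u ≠ v := by simpa [SimpleGraph.mem_edgeSet] using he
  have hu : u ∈ T := hT' u (Sym2.mem_mk_left u v)
  have hv : v ∈ T := hT' v (Sym2.mem_mk_right u v)
  have hadj := hT (mem_coe.2 hu) (mem_coe.2 hv) huv
  rw [graphOfEdgeVec_adj] at hadj
  obtain ⟨_, hx⟩ := hadj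
  simp only [plant, Bool.or_eq_true, decide_eq_true_eq] at hx
  rcases hx with hx | hx
  · exact hx
  · exact absurd hx hS'

/-- If `S` (`|S| = k ≥ 1`) is not the unique maximum clique of `plant S x`, some `k`-set `T ≠ S`
has all its constrained edges present in `x`. [folklore] -/
theorem exists_of_not_isUniqueMaxClique {k : ℕ} (hk : 1 ≤ k) {S : Finset (Fin n)}
    (hS : S.card = k) {x : EdgeVec n}
    (h : ¬ IsUniqueMaxClique (graphOfEdgeVec (plant S x)) S) :
    ∃ T ∈ (powersetCard k (univ : Finset (Fin n))).erase S,
      ∀ e ∈ crossEdges(S, T), x e = true := by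
  classical
  unfold IsUniqueMaxClique at h
  push Not at h
  obtain ⟨T, hTc, hle, hne⟩ := h (isClique_plant S x)
  have hTS : ¬ T ⊆ S := fun hsub => hne (eq_of_subset_of_card_le hsub (hS ▸ hle))
  obtain ⟨v, hvT, hvS⟩ := not_subset.1 hTS
  obtain ⟨T'', hT''sub, hT''card⟩ := exists_subset_card_eq (s := T.erase v) (n := k - 1)
    (by rw [card_erase_of_mem hvT]; omega)
  have hvT'' : v ∉ T'' := fun hv => (mem_erase.1 (hT''sub hv)).1 rfl
  refine ⟨insert v T'', ?_, eq_true_of_isClique_plant (hTc.subset ?_)⟩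
  · rw [mem_erase, mem_powersetCard]
    refine ⟨fun heq => hvS (heq ▸ mem_insert_self v T''), subset_univ _, ?_⟩
    rw [card_insert_of_notMem hvT'', hT''card]
    omega
  · intro w hw
    simp only [coe_insert, Set.mem_insert_iff, mem_coe] at hw
    rcases hw with rfl | hw
    · exact hvT
    · exact (mem_erase.1 (hT''sub hw)).2

/-! ### Probability of forcing a set of edges -/

/-- Injection count: the bit vectors that are `true` on `D`, times `2^{|D|}`, number at most all
bit vectors. [folklore] -/
theorem card_filter_forall_eq_true_mul_le {E : Type*} [Fintype E] [DecidableEq E]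
    (D : Finset E) :
    (univ.filter fun x : E → Bool => ∀ e ∈ D, x e = true).card * 2 ^ D.card ≤
      2 ^ Fintype.card E := by
  classical
  set F := univ.filter fun x : E → Bool => ∀ e ∈ D, x e = true with hF
  let g : (E → Bool) × (D → Bool) → (E → Bool) :=
    fun p e => if h : e ∈ D then p.2 ⟨e, h⟩ else p.1 e
  have hinj : Set.InjOn g ↑(F ×ˢ (univ : Finset (D → Bool))) := by
    rintro ⟨x, y⟩ hxy ⟨x', y'⟩ hxy' heq
    simp only [coe_product, Set.mem_prod, mem_coe, hF, mem_filter, mem_univ, true_and] at hxy hxy'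
    have hpt : ∀ e, g (x, y) e = g (x', y') e := fun e => congr_fun heq e
    refine Prod.ext (funext fun e => ?_) (funext fun e => ?_)
    · change x e = x' e
      by_cases he : e ∈ D
      · rw [hxy.1 e he, hxy'.1 e he]
      · simpa [g, he] using hpt e
    · obtain ⟨e, he⟩ := e
      simpa [g, he] using hpt e
  have h := card_le_card_of_injOn g (fun _ _ => mem_coe.2 (mem_univ _)) hinj
  simpa [card_product, Fintype.card_fun, Fintype.card_coe, Fintype.card_bool] using h

/-- Under `G(n, 1/2)` a fixed set `D` of edges is entirely present with probability at most
`2^{-|D|}` (in fact exactly). [folklore] -/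
theorem toOuterMeasure_forall_eq_true_le (D : Finset (⊤ : SimpleGraph (Fin n)).edgeSet) :
    (erdosRenyiHalf n).toOuterMeasure {x | ∀ e ∈ D, x e = true} ≤ 2⁻¹ ^ D.card := by
  classical
  have hcount := card_filter_forall_eq_true_mul_le D
  have huniv : ((univ : Finset (EdgeVec n)).card : ℝ≥0∞) =
      2 ^ Fintype.card (⊤ : SimpleGraph (Fin n)).edgeSet := by
    rw [card_univ, Fintype.card_fun, Fintype.card_bool]
    push_cast
    rfl
  have h2 : (2 : ℝ≥0∞) ^ D.card ≠ 0 := pow_ne_zero _ two_ne_zero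
  have h2' : (2 : ℝ≥0∞) ^ D.card ≠ ∞ := ENNReal.pow_ne_top ENNReal.ofNat_ne_top
  have key : ∀ N : ℕ, N * 2 ^ D.card ≤ 2 ^ Fintype.card (⊤ : SimpleGraph (Fin n)).edgeSet →
      (N : ℝ≥0∞) ≤ 2⁻¹ ^ D.card * 2 ^ Fintype.card (⊤ : SimpleGraph (Fin n)).edgeSet := by
    intro N hN
    calc (N : ℝ≥0∞) = 2⁻¹ ^ D.card * ((N : ℝ≥0∞) * 2 ^ D.card) := by
          rw [mul_comm _ ((2 : ℝ≥0∞) ^ D.card), ← mul_assoc, ← ENNReal.inv_pow,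
            ENNReal.inv_mul_cancel h2 h2', one_mul]
      _ ≤ 2⁻¹ ^ D.card * 2 ^ Fintype.card (⊤ : SimpleGraph (Fin n)).edgeSet := by
          gcongr; exact_mod_cast hN
  rw [erdosRenyiHalf, PMF.uniformOfFintype, PMF.toOuterMeasure_uniformOfFinset_apply, huniv,
    ENNReal.div_le_iff (pow_ne_zero _ two_ne_zero) (ENNReal.pow_ne_top ENNReal.ofNat_ne_top)]
  refine key _ ?_
  convert hcount using 3
  ext x
  simp

/-! ### Counting constrained edges and competing sets -/

/-- Double counting: ordered pairs `(u, v)`, `u ∈ T \ S`, `v ∈ T`, `u ≠ v`, hit each constrained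
edge at most twice, so `|T \ S| (|T| - 1) ≤ 2 |crossEdges(S, T)|`. [folklore] -/
theorem card_sdiff_mul_le_two_mul_card_crossEdges (S T : Finset (Fin n)) :
    (T \ S).card * (T.card - 1) ≤ 2 * (crossEdges(S, T)).card := by
  classical
  set P := ((T \ S) ×ˢ T).filter fun p : Fin n × Fin n => p.1 ≠ p.2 with hP
  -- cardinality of `P`
  have hdiag : ((T \ S) ×ˢ T).filter (fun p : Fin n × Fin n => ¬ p.1 ≠ p.2) =
      (T \ S).map ⟨fun u => (u, u), fun a b h => (Prod.ext_iff.1 h).1⟩ := by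
    ext ⟨u, v⟩
    simp only [mem_filter, mem_product, Finset.mem_sdiff, ne_eq, not_not, Finset.mem_map,
      Function.Embedding.coeFn_mk, Prod.mk.injEq]
    constructor
    · rintro ⟨⟨⟨huT, huS⟩, -⟩, rfl⟩
      exact ⟨u, ⟨huT, huS⟩, rfl, rfl⟩
    · rintro ⟨w, ⟨hwT, hwS⟩, rfl, rfl⟩
      exact ⟨⟨⟨hwT, hwS⟩, hwT⟩, rfl⟩
  have hPcard : P.card = (T \ S).card * (T.card - 1) := by
    have hsum := Finset.card_filter_add_card_filter_not
      (s := (T \ S) ×ˢ T) (fun p : Fin n × Fin n => p.1 ≠ p.2)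
    rw [hdiag, card_map, card_product] at hsum
    rw [hP, Nat.mul_sub_one, ← hsum, Nat.add_sub_cancel]
  -- the pair map and its fibres
  let g : Fin n × Fin n → Sym2 (Fin n) := fun p => s(p.1, p.2)
  have hfib : ∀ a ∈ P.image g, (P.filter fun p => g p = a).card ≤ 2 := by
    intro a _
    induction a using Sym2.ind with
    | _ a₁ a₂ =>
      calc (P.filter fun p => g p = s(a₁, a₂)).card
          ≤ (insert (a₁, a₂) ({(a₂, a₁)} : Finset (Fin n × Fin n))).card := by
            refine card_le_card fun p hp => ?_
            simp only [mem_filter, g, Sym2.eq_iff] at hp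
            rcases hp.2 with ⟨h1, h2⟩ | ⟨h1, h2⟩
            · rw [mem_insert]; exact Or.inl (Prod.ext h1 h2)
            · rw [mem_insert, mem_singleton]; exact Or.inr (Prod.ext h1 h2)
        _ ≤ 2 := (card_insert_le _ _).trans (by rw [card_singleton])
  have himg : P.image g ⊆ (crossEdges(S, T)).image Subtype.val := by
    intro a ha
    obtain ⟨⟨u, v⟩, hp, rfl⟩ := mem_image.1 ha
    simp only [hP, mem_filter, mem_product, Finset.mem_sdiff, ne_eq] at hp
    obtain ⟨⟨⟨huT, huS⟩, hvT⟩, huv⟩ := hp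
    refine mem_image.2 ⟨⟨s(u, v), by simpa [SimpleGraph.mem_edgeSet] using huv⟩, ?_, rfl⟩
    simp only [mem_filter, mem_univ, true_and, Finset.mem_sym2_iff, Sym2.mem_iff,
      forall_eq_or_imp, forall_eq]
    exact ⟨⟨huT, hvT⟩, fun h => huS h.1⟩
  calc (T \ S).card * (T.card - 1) = P.card := hPcard.symm
    _ ≤ 2 * (P.image g).card := card_le_mul_card_image P 2 hfib
    _ ≤ 2 * ((crossEdges(S, T)).image Subtype.val).card := by gcongr
    _ = 2 * (crossEdges(S, T)).card := by rw [card_image_of_injective _ Subtype.val_injective]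

/-- The `k`-sets `T` with `|T \ S| = j` (for `|S| = k`) number at most `n^j k^j`: `T ↦ (T \ S, S \ T)`
is injective into pairs of `j`-subsets of `univ \ S` and of `S`. [folklore] -/
theorem card_filter_card_sdiff_eq_le {k : ℕ} {S : Finset (Fin n)} (hS : S.card = k) (j : ℕ) :
    ((powersetCard k (univ : Finset (Fin n))).filter fun T => (T \ S).card = j).card ≤
      n ^ j * k ^ j := by
  classical
  set A := (powersetCard k (univ : Finset (Fin n))).filter fun T => (T \ S).card = j
  have hmaps : Set.MapsTo (fun T : Finset (Fin n) => (T \ S, S \ T)) ↑A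
      ↑(powersetCard j (univ \ S) ×ˢ powersetCard j S) := by
    intro T hT
    simp only [A, coe_filter, Set.mem_setOf_eq, mem_powersetCard] at hT
    obtain ⟨⟨-, hTcard⟩, hTj⟩ := hT
    simp only [coe_product, Set.mem_prod, mem_coe, mem_powersetCard]
    refine ⟨⟨sdiff_subset_sdiff (subset_univ _) le_rfl, hTj⟩, sdiff_subset, ?_⟩
    have h1 := card_sdiff_add_card_inter T S
    have h2 := card_sdiff_add_card_inter S T
    rw [inter_comm] at h2
    omega
  have hinj : Set.InjOn (fun T : Finset (Fin n) => (T \ S, S \ T)) ↑A := by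
    intro T _ T' _ heq
    simp only [Prod.mk.injEq] at heq
    obtain ⟨h1, h2⟩ := heq
    ext x
    by_cases hx : x ∈ S
    · have := congrArg (x ∈ ·) h2
      simp only [Finset.mem_sdiff, hx, true_and, eq_iff_iff, not_iff_not] at this
      exact this
    · have := congrArg (x ∈ ·) h1
      simp only [Finset.mem_sdiff, hx, not_false_eq_true, and_true, eq_iff_iff] at this
      exact this
  calc A.card ≤ (powersetCard j (univ \ S) ×ˢ powersetCard j S).card :=
        card_le_card_of_injOn _ hmaps hinj
    _ = (n - k).choose j * k.choose j := by
        rw [card_product, card_powersetCard, card_powersetCard, card_sdiff_of_subset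
          (subset_univ _), card_univ, Fintype.card_fin, hS]
    _ ≤ n ^ j * k ^ j := by
        gcongr
        · exact (Nat.choose_le_pow _ _).trans (Nat.pow_le_pow_left (Nat.sub_le _ _) _)
        · exact Nat.choose_le_pow _ _

/-! ### The bound for a fixed planted set, and on average -/

/-- An elementary estimate: if `P ≤ 1` and `P ≤ Σ_{j=1}^{k} (n k r)^j` with `k ≤ n`, then
`P ≤ n³ r`. [folklore] -/
theorem le_cube_mul_of_le_sum {P r : ℝ≥0∞} {n k : ℕ} (hkn : k ≤ n) (hP1 : P ≤ 1)
    (hP : P ≤ ∑ j ∈ Icc 1 k, ((n : ℝ≥0∞) * k * r) ^ j) : P ≤ (n : ℝ≥0∞) ^ 3 * r := by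
  set q : ℝ≥0∞ := (n : ℝ≥0∞) * k * r with hq
  have hkn' : (k : ℝ≥0∞) ≤ n := by exact_mod_cast hkn
  have hq3 : (k : ℝ≥0∞) * q ≤ (n : ℝ≥0∞) ^ 3 * r := by
    calc (k : ℝ≥0∞) * q = k * n * k * r := by rw [hq]; ring
      _ ≤ n * n * n * r := by gcongr
      _ = (n : ℝ≥0∞) ^ 3 * r := by ring
  rcases le_or_gt q 1 with hq1 | hq1
  · refine hP.trans (le_trans ?_ hq3)
    calc ∑ j ∈ Icc 1 k, q ^ j ≤ ∑ _j ∈ Icc 1 k, q := by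
          refine sum_le_sum fun j hj => ?_
          obtain ⟨hj1, -⟩ := mem_Icc.1 hj
          calc q ^ j = q * q ^ (j - 1) := by rw [← pow_succ', Nat.sub_add_cancel hj1]
            _ ≤ q * 1 := by gcongr; exact pow_le_one₀ zero_le hq1
            _ = q := mul_one q
      _ = k * q := by rw [sum_const, Nat.card_Icc, Nat.add_sub_cancel, nsmul_eq_mul]
  · have hk1 : (1 : ℝ≥0∞) ≤ k := by
      rcases Nat.eq_zero_or_pos k with rfl | hk
      · simp [hq] at hq1
      · exact_mod_cast hk
    calc P ≤ 1 := hP1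
      _ ≤ q := hq1.le
      _ = 1 * q := (one_mul q).symm
      _ ≤ k * q := by gcongr
      _ ≤ (n : ℝ≥0∞) ^ 3 * r := hq3

/-- **Fixed planted set.** For `|S| = k`, `1 ≤ k ≤ n`, the probability over `x ∼ G(n,1/2)` that `S`
is not the unique maximum clique of `plant S x` is at most `n³ 2^{-⌊(k-1)/2⌋}`. [folklore] -/
theorem toOuterMeasure_not_isUniqueMaxClique_plant_le {k : ℕ} (hk : 1 ≤ k) (hkn : k ≤ n)
    {S : Finset (Fin n)} (hS : S.card = k) :
    (erdosRenyiHalf n).toOuterMeasure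
        {x | ¬ IsUniqueMaxClique (graphOfEdgeVec (plant S x)) S} ≤
      (n : ℝ≥0∞) ^ 3 * 2⁻¹ ^ ((k - 1) / 2) := by
  classical
  set r : ℝ≥0∞ := 2⁻¹ ^ ((k - 1) / 2) with hr
  set 𝒯 := (powersetCard k (univ : Finset (Fin n))).erase S with h𝒯
  have hr1 : r ≤ 1 := pow_le_one₀ zero_le (ENNReal.inv_le_one.2 one_le_two)
  -- union bound over competing sets
  have hsub : {x : EdgeVec n | ¬ IsUniqueMaxClique (graphOfEdgeVec (plant S x)) S} ⊆
      ⋃ T ∈ 𝒯, {x | ∀ e ∈ crossEdges(S, T), x e = true} := by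
    intro x hx
    obtain ⟨T, hT, hTx⟩ := exists_of_not_isUniqueMaxClique hk hS hx
    exact Set.mem_biUnion hT hTx
  have hT_bound : ∀ T ∈ 𝒯, (erdosRenyiHalf n).toOuterMeasure
      {x | ∀ e ∈ crossEdges(S, T), x e = true} ≤ r ^ (T \ S).card := by
    intro T hT
    rw [h𝒯, mem_erase, mem_powersetCard] at hT
    obtain ⟨-, -, hTcard⟩ := hT
    refine (toOuterMeasure_forall_eq_true_le _).trans ?_
    rw [hr, ← pow_mul]
    refine pow_le_pow_of_le_one zero_le (ENNReal.inv_le_one.2 one_le_two) ?_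
    have h2 := card_sdiff_mul_le_two_mul_card_crossEdges S T
    rw [hTcard] at h2
    have hdiv : (k - 1) / 2 * 2 ≤ k - 1 := Nat.div_mul_le_self _ _
    calc (k - 1) / 2 * (T \ S).card ≤ (2 * (crossEdges(S, T)).card) / 2 := by
          refine (Nat.le_div_iff_mul_le two_pos).2 ?_
          calc (k - 1) / 2 * (T \ S).card * 2 = (T \ S).card * ((k - 1) / 2 * 2) := by ring
            _ ≤ (T \ S).card * (k - 1) := Nat.mul_le_mul_left _ hdiv
            _ ≤ 2 * (crossEdges(S, T)).card := h2
      _ = (crossEdges(S, T)).card := by omega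
  have hmaps : ∀ T ∈ 𝒯, (T \ S).card ∈ Icc 1 k := by
    intro T hT
    rw [h𝒯, mem_erase, mem_powersetCard] at hT
    obtain ⟨hne, -, hTcard⟩ := hT
    rw [mem_Icc]
    refine ⟨?_, (card_le_card sdiff_subset).trans hTcard.le⟩
    rw [Nat.one_le_iff_ne_zero, Ne, card_eq_zero, sdiff_eq_empty_iff_subset]
    exact fun hsub => hne (eq_of_subset_of_card_le hsub (by rw [hS, hTcard]))
  have hP1 : (erdosRenyiHalf n).toOuterMeasure
      {x | ¬ IsUniqueMaxClique (graphOfEdgeVec (plant S x)) S} ≤ 1 := by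
    refine le_trans ((erdosRenyiHalf n).toOuterMeasure.mono (Set.subset_univ _)) ?_
    exact ((PMF.toOuterMeasure_apply_eq_one_iff _ _).2 (Set.subset_univ _)).le
  refine le_cube_mul_of_le_sum hkn hP1 ?_
  calc (erdosRenyiHalf n).toOuterMeasure
        {x | ¬ IsUniqueMaxClique (graphOfEdgeVec (plant S x)) S}
      ≤ (erdosRenyiHalf n).toOuterMeasure
          (⋃ T ∈ 𝒯, {x | ∀ e ∈ crossEdges(S, T), x e = true}) :=
        (erdosRenyiHalf n).toOuterMeasure.mono hsub
    _ ≤ ∑ T ∈ 𝒯, (erdosRenyiHalf n).toOuterMeasure {x | ∀ e ∈ crossEdges(S, T), x e = true} :=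
        MeasureTheory.measure_biUnion_finset_le _ _
    _ ≤ ∑ T ∈ 𝒯, r ^ (T \ S).card := sum_le_sum hT_bound
    _ = ∑ j ∈ Icc 1 k, ∑ T ∈ 𝒯 with (T \ S).card = j, r ^ (T \ S).card :=
        (sum_fiberwise_of_maps_to hmaps _).symm
    _ ≤ ∑ j ∈ Icc 1 k, ((n : ℝ≥0∞) * k * r) ^ j := by
        refine sum_le_sum fun j _ => ?_
        calc ∑ T ∈ 𝒯 with (T \ S).card = j, r ^ (T \ S).card
            = ∑ T ∈ 𝒯 with (T \ S).card = j, r ^ j :=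
              sum_congr rfl fun T hT => by rw [(mem_filter.1 hT).2]
          _ = (𝒯.filter fun T => (T \ S).card = j).card * r ^ j := by
              rw [sum_const, nsmul_eq_mul]
          _ ≤ ((powersetCard k (univ : Finset (Fin n))).filter
                fun T => (T \ S).card = j).card * r ^ j := by
              gcongr
              exact erase_subset _ _
          _ ≤ ((n ^ j * k ^ j : ℕ) : ℝ≥0∞) * r ^ j := by
              gcongr
              exact_mod_cast card_filter_card_sdiff_eq_le hS j
          _ = ((n : ℝ≥0∞) * k * r) ^ j := by push_cast; ring

/-- **Union bound for the planted model.** For `1 ≤ k ≤ n`, under `G(n, 1/2, k)` the planted set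
fails to be the unique maximum clique with probability at most `n³ 2^{-⌊(k-1)/2⌋}`.
[Jerrum 1992, §1; AKS 1998, §1] [folklore] -/
theorem toOuterMeasure_not_isUniqueMaxClique_le {k : ℕ} (hk : 1 ≤ k) (hkn : k ≤ n) :
    (plantedCliqueJoint n k).toOuterMeasure
        {p | ¬ IsUniqueMaxClique (graphOfEdgeVec p.2) p.1} ≤
      (n : ℝ≥0∞) ^ 3 * 2⁻¹ ^ ((k - 1) / 2) := by
  classical
  rw [plantedCliqueJoint, PMF.toOuterMeasure_bind_apply]
  set u := PMF.uniformOfFinset (kSubsets n k) (kSubsets_nonempty n k) with hu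
  calc ∑' S, u S * ((erdosRenyiHalf n).map fun x => (S, plant S x)).toOuterMeasure
          {p | ¬ IsUniqueMaxClique (graphOfEdgeVec p.2) p.1}
      ≤ ∑' S, u S * ((n : ℝ≥0∞) ^ 3 * 2⁻¹ ^ ((k - 1) / 2)) := by
        refine ENNReal.tsum_le_tsum fun S => ?_
        by_cases hS : S ∈ kSubsets n k
        · gcongr
          rw [PMF.toOuterMeasure_map_apply]
          have hcard : S.card = k := (card_of_mem_kSubsets hS).trans (min_eq_left hkn)
          exact toOuterMeasure_not_isUniqueMaxClique_plant_le hk hkn hcard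
        · rw [hu, PMF.uniformOfFinset_apply_of_notMem (kSubsets_nonempty n k) hS, zero_mul, zero_mul]
    _ = (n : ℝ≥0∞) ^ 3 * 2⁻¹ ^ ((k - 1) / 2) := by
        rw [ENNReal.tsum_mul_right, PMF.tsum_coe, one_mul]

/-- Complementary form: `Pr[S is the unique maximum clique] ≥ 1 - n³ 2^{-⌊(k-1)/2⌋}` for
`1 ≤ k ≤ n`. [Jerrum 1992, §1; AKS 1998, §1] [folklore] -/
theorem one_sub_le_uniqueMaxCliqueProb {k : ℕ} (hk : 1 ≤ k) (hkn : k ≤ n) :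
    1 - (n : ℝ≥0∞) ^ 3 * 2⁻¹ ^ ((k - 1) / 2) ≤ uniqueMaxCliqueProb n k := by
  have h1 : (plantedCliqueJoint n k).toOuterMeasure Set.univ = 1 :=
    (PMF.toOuterMeasure_apply_eq_one_iff _ _).2 (Set.subset_univ _)
  have hunion : (Set.univ : Set (Finset (Fin n) × EdgeVec n)) =
      {p | IsUniqueMaxClique (graphOfEdgeVec p.2) p.1} ∪
        {p | ¬ IsUniqueMaxClique (graphOfEdgeVec p.2) p.1} := by
    ext p; simp only [Set.mem_univ, Set.mem_union, Set.mem_setOf_eq, true_iff]; exact em _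
  refine tsub_le_iff_right.2 ?_
  calc (1 : ℝ≥0∞) = (plantedCliqueJoint n k).toOuterMeasure Set.univ := h1.symm
    _ ≤ uniqueMaxCliqueProb n k + (plantedCliqueJoint n k).toOuterMeasure
          {p | ¬ IsUniqueMaxClique (graphOfEdgeVec p.2) p.1} := by
        rw [hunion]; exact MeasureTheory.measure_union_le _ _
    _ ≤ uniqueMaxCliqueProb n k + (n : ℝ≥0∞) ^ 3 * 2⁻¹ ^ ((k - 1) / 2) := by
        gcongr; exact toOuterMeasure_not_isUniqueMaxClique_le hk hkn

/-! ### Asymptotics in the regime `k ≥ c √n` -/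

/-- The real estimate: if `c √n ≤ k` then `n³ 2^{-⌊(k-1)/2⌋} ≤ 2 n³ e^{-(c log 2/2) √n}`.
[folklore] -/
theorem cube_mul_half_pow_le {c : ℝ} {n k : ℕ} (hck : c * Real.sqrt n ≤ k) :
    (n : ℝ) ^ 3 * 2⁻¹ ^ ((k - 1) / 2) ≤
      2 * (n : ℝ) ^ 3 * Real.exp (-(c * Real.log 2 / 2) * Real.sqrt n) := by
  set m := (k - 1) / 2 with hm
  have h2m : (k : ℝ) ≤ 2 * m + 2 := by
    have : k ≤ 2 * m + 2 := by omega
    exact_mod_cast this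
  have hlog : 0 < Real.log 2 := Real.log_pos one_lt_two
  have hpow : (2⁻¹ : ℝ) ^ m = Real.exp (-(Real.log 2 * m)) := by
    rw [Real.exp_neg, mul_comm, Real.exp_nat_mul, Real.exp_log two_pos, inv_pow]
  have hexp : Real.exp (-(Real.log 2 * m)) ≤
      2 * Real.exp (-(c * Real.log 2 / 2) * Real.sqrt n) := by
    rw [show (2 : ℝ) * Real.exp (-(c * Real.log 2 / 2) * Real.sqrt n) =
        Real.exp (Real.log 2 + -(c * Real.log 2 / 2) * Real.sqrt n) by
          rw [Real.exp_add, Real.exp_log two_pos]]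
    refine Real.exp_le_exp.2 ?_
    have : Real.log 2 * (c * Real.sqrt n) ≤ Real.log 2 * (2 * m + 2) :=
      mul_le_mul_of_nonneg_left (hck.trans h2m) hlog.le
    nlinarith
  calc (n : ℝ) ^ 3 * 2⁻¹ ^ m = (n : ℝ) ^ 3 * Real.exp (-(Real.log 2 * m)) := by rw [hpow]
    _ ≤ (n : ℝ) ^ 3 * (2 * Real.exp (-(c * Real.log 2 / 2) * Real.sqrt n)) := by
        gcongr
    _ = 2 * (n : ℝ) ^ 3 * Real.exp (-(c * Real.log 2 / 2) * Real.sqrt n) := by ring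

/-- `2 n³ e^{-b √n} → 0` for `b > 0`. [folklore] -/
theorem tendsto_cube_mul_exp_neg_sqrt {b : ℝ} (hb : 0 < b) :
    Tendsto (fun n : ℕ => 2 * (n : ℝ) ^ 3 * Real.exp (-b * Real.sqrt n)) atTop (𝓝 0) := by
  have hx : Tendsto (fun n : ℕ => b * Real.sqrt n) atTop atTop :=
    (Real.tendsto_sqrt_atTop.comp tendsto_natCast_atTop_atTop).const_mul_atTop hb
  have h := ((Real.tendsto_pow_mul_exp_neg_atTop_nhds_zero 6).comp hx).const_mul (2 / b ^ 6)
  rw [mul_zero] at h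
  refine h.congr fun n => ?_
  have hsq : Real.sqrt n ^ 2 = (n : ℝ) := Real.sq_sqrt (Nat.cast_nonneg n)
  simp only [Function.comp_apply]
  rw [mul_pow, show Real.sqrt (n : ℝ) ^ 6 = (Real.sqrt n ^ 2) ^ 3 by ring, hsq, neg_mul]
  field_simp

/-- **The planted clique is the unique maximum clique w.h.p. for `k ≥ c √n`.** If `c > 0` and
eventually `c √n ≤ k n ≤ n`, then `uniqueMaxCliqueProb n (k n) → 1`.
[AKS 1998, §1 ("the unique largest clique of size `k`"); Jerrum 1992, §1] [folklore] -/
theorem plantedCliqueUniqueWhp_of_sqrt_le {c : ℝ} (hc : 0 < c) {k : ℕ → ℕ}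
    (hk : ∀ᶠ n : ℕ in atTop, c * Real.sqrt n ≤ k n ∧ k n ≤ n) :
    PlantedCliqueUniqueWhp k := by
  -- the error term and its limit
  set ε : ℕ → ℝ≥0∞ := fun n => (n : ℝ≥0∞) ^ 3 * 2⁻¹ ^ ((k n - 1) / 2) with hε
  have hk1 : ∀ᶠ n : ℕ in atTop, 1 ≤ k n := by
    have h1 : ∀ᶠ n : ℕ in atTop, (1 : ℝ) ≤ c * Real.sqrt n :=
      ((Real.tendsto_sqrt_atTop.comp tendsto_natCast_atTop_atTop).const_mul_atTop hc).eventually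
        (eventually_ge_atTop 1)
    filter_upwards [hk, h1] with n hn h1n
    have : (1 : ℝ) ≤ k n := h1n.trans hn.1
    exact_mod_cast this
  have hreal : Tendsto (fun n : ℕ => (n : ℝ) ^ 3 * 2⁻¹ ^ ((k n - 1) / 2)) atTop (𝓝 0) := by
    refine squeeze_zero' (Eventually.of_forall fun n => by positivity) ?_
      (tendsto_cube_mul_exp_neg_sqrt (b := c * Real.log 2 / 2)
        (by have := Real.log_pos one_lt_two; positivity))
    filter_upwards [hk] with n hn
    exact cube_mul_half_pow_le hn.1
  have hεeq : ∀ n : ℕ, ε n = ENNReal.ofReal ((n : ℝ) ^ 3 * 2⁻¹ ^ ((k n - 1) / 2)) := by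
    intro n
    rw [hε, ENNReal.ofReal_mul (by positivity), ENNReal.ofReal_pow (Nat.cast_nonneg _),
      ENNReal.ofReal_natCast, ENNReal.ofReal_pow (by norm_num),
      ENNReal.ofReal_inv_of_pos two_pos, ENNReal.ofReal_ofNat]
  have hεlim : Tendsto ε atTop (𝓝 0) := by
    have h := ENNReal.tendsto_ofReal hreal
    rw [ENNReal.ofReal_zero] at h
    exact h.congr fun n => (hεeq n).symm
  -- squeeze between `1 - ε n` and `1`
  have hlow : Tendsto (fun n => 1 - ε n) atTop (𝓝 1) := by
    have h := ENNReal.Tendsto.sub (tendsto_const_nhds (x := (1 : ℝ≥0∞))) hεlim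
      (Or.inl ENNReal.one_ne_top)
    rwa [tsub_zero] at h
  refine tendsto_of_tendsto_of_tendsto_of_le_of_le' hlow tendsto_const_nhds ?_
    (Eventually.of_forall fun n => ?_)
  · filter_upwards [hk, hk1] with n hn hn1
    exact one_sub_le_uniqueMaxCliqueProb hn1 hn.2
  · refine le_trans ((plantedCliqueJoint n (k n)).toOuterMeasure.mono (Set.subset_univ _)) ?_
    exact ((PMF.toOuterMeasure_apply_eq_one_iff _ _).2 (Set.subset_univ _)).le

end Literature.Probability.RandomGraphs.PlantedClique

end
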